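import Literature.AlgebraicGeometry.Frobenioids.ElementaryIsFrobenioid
import Literature.AlgebraicGeometry.Frobenioids.Thm49Sub
import Literature.AnabelianGeometry.EtaleTheta.MonoprimeStructure
import Mathlib.Data.NNRat.Order
import HarnessLib

/-!
# [FrdI] Theorem 4.9, sub-DAG row T49-L08 as typed (`FrdI.T49.PsiPreservesTwinPrimary`): a kernel
# counter-model — the negative edge of finding T49-F1 (GAP-LEDGER G-w4d105-1)

Mochizuki, *The geometry of Frobenioids I: the general theory*, Kyushu J. Math. **62** (2008)
293–400, §4, proof of Theorem 4.9, kurims text p. 90 [cite: MochizukiFrdI2008, Thm. 4.9 p.90].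

The statements file `Thm49Sub.lean` (seat abc-iut-L1-t14, p412095) types row T49-L08 as
`FrdI.T49.PsiPreservesTwinPrimary`, requiring of the two squares only that they COMMUTE and be
CARTESIAN AMONG PRE-STEPS; print (p. 90 l. 31) says "cartesian commutative diagrams of pre-steps AS IN
PROPOSITION 4.1, (iii)", i.e. over CO-PRIMARY pairs. The repaired statement (with the two co-primarity
hypotheses) is PROVED in `TwinPrimaryTransport.lean` (`FrdI.T49.isTwinPrimary_map_of_coprimary_squares`,
p413650). THIS file records, kernel-checked, that the unprimed statement is FALSE at universe level 0:
`FrdI.T49.not_psiPreservesTwinPrimary : ¬ PsiPreservesTwinPrimary.{0, 0, 0, 0, 0}`.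

WITNESS (the rank-one lattice configuration of the finding): the elementary Frobenioid `F_Φ → F_{Φ^char}`
(Prop. 1.5; found's `ElemFrobenioid.isFrobenioid_toChar`) of the CONSTANT monoid `Φ = (ℚ_{≥0}, +)` on the
one-morphism base category — a Frobenioid of isotropic (Prop. 1.5 (i)) and perfect (Prop. 1.5 (iii),
`ℚ_{≥0}` is perfect) type whose divisor monoids `Φ^char(∗) ≅ ℚ_{≥0}` are monoprime, hence perf-factorial
(`IsMonoprime.isPerfFactorial`); `Ψ :=` the identity equivalence (so every "`Ψ` preserves …" binder
of `T42.Setting` / of the row holds trivially). Arrows (all on the unique object): `β := (id, 1, 1)`,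
`δ := β`, `γ := γ' := id`, `γ'' := β`, `α := (id, 2, 1)`, `δ' := β ≫ α`. Then `α`, `β` are primary
steps, the squares `γ' ≫ δ = γ ≫ β`, `γ' ≫ δ' = γ'' ≫ α` commute and are cartesian among pre-steps
(pre-steps are monomorphisms), `γ ≫ β` and `γ''` are Div-equivalent — yet `Div(α) = 2 ≠ 1 = (Φ β)⁻¹ Div(β)`,
so `α`, `β` are NOT twin-primary. (The pair `(δ', α)` is not co-primary — exactly the hypothesis the
typed row omits.) Consumers must bind the primed/repaired statement, never the unprimed one.
Nothing of [FrdI] is contradicted: the paper's sentence carries the co-primarity.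
-/

noncomputable section

namespace Literature.AlgebraicGeometry.Frobenioids

open CategoryTheory Opposite

namespace FrdI.T49.Witness

/-! ### The monoid `ℚ_{≥0}` (written multiplicatively) -/

/-- The divisor monoid of the witness: `(ℚ_{≥0}, +)` written multiplicatively. [cite: MochizukiFrdI2008, §0 p.10] -/
abbrev M : Type := Multiplicative NNRat

/-- Units of `(ℚ_{≥0}, +)` are trivial. [cite: MochizukiFrdI2008, §0 p.11] -/
theorem eq_one_of_isUnit_M (x : M) (hx : IsUnit x) : x = 1 := by
  obtain ⟨u, rfl⟩ := hx
  have h : u.1.toAdd + u.2.toAdd = 0 := by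
    have := congrArg Multiplicative.toAdd u.3
    rwa [toAdd_mul, toAdd_one] at this
  exact congrArg Multiplicative.ofAdd (add_eq_zero.mp h).1

/-- `(ℚ_{≥0}, +)` is of characteristic type (no units). [cite: MochizukiFrdI2008, §0 p.11] -/
theorem isOfCharType_M : IsOfCharType M :=
  ⟨fun u _ _ => Units.ext (eq_one_of_isUnit_M _ u.isUnit)⟩

/-- `(ℚ_{≥0}, +)` is integral (cancellative). [cite: MochizukiFrdI2008, §0 p.11] -/
theorem isIntegral_M : IsIntegral M := isIntegral_iff_isCancelMul.mpr inferInstance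

/-- Two elements of `N^gp` with the same image agree up to a common factor. [cite: MochizukiFrdI2008, §0 p.11] -/
private theorem gp_of_eq_of_iff {N : Type} [CommMonoid N] {a b : N} :
    Algebra.GrothendieckGroup.of a = Algebra.GrothendieckGroup.of b ↔ ∃ c : N, c * a = c * b :=
  ((Localization.monoidOf (⊤ : Submonoid N)).eq_iff_exists).trans
    ⟨fun ⟨c, h⟩ => ⟨c, h⟩, fun ⟨c, h⟩ => ⟨⟨c, Submonoid.mem_top c⟩, h⟩⟩

/-- Every element of `N^gp` is a fraction. [cite: MochizukiFrdI2008, §0 p.11] -/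
private theorem gp_exists_eq_div {N : Type} [CommMonoid N] (x : Algebra.GrothendieckGroup N) :
    ∃ a b : N, x = Algebra.GrothendieckGroup.of a / Algebra.GrothendieckGroup.of b := by
  obtain ⟨⟨a, b⟩, h⟩ := (Localization.monoidOf (⊤ : Submonoid N)).surj x
  exact ⟨a, b, eq_div_iff_mul_eq'.mpr h⟩

/-- `(ℚ_{≥0}, +)` is saturated: if `n · (a - b) ≥ 0` then `a - b ≥ 0`. [cite: MochizukiFrdI2008, §0 p.11] -/
theorem isSaturated_M : IsSaturated M := by
  refine ⟨fun x n hn ⟨m₀, hx⟩ => ?_⟩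
  obtain ⟨a, b, rfl⟩ := gp_exists_eq_div x
  rw [div_pow, ← map_pow, ← map_pow, eq_div_iff_mul_eq', ← map_mul, gp_of_eq_of_iff] at hx
  obtain ⟨c, hc⟩ := hx
  have hc' : m₀ * b ^ n = a ^ n := mul_left_cancel hc
  have hadd : m₀.toAdd + n • b.toAdd = n • a.toAdd := by
    have := congrArg Multiplicative.toAdd hc'
    rwa [toAdd_mul, toAdd_pow, toAdd_pow] at this
  have hle : b.toAdd ≤ a.toAdd := by
    have h1 : n • b.toAdd ≤ n • a.toAdd := by rw [← hadd]; exact le_add_self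
    exact le_of_nsmul_le_nsmul_right hn.ne' h1
  refine ⟨Multiplicative.ofAdd (a.toAdd - b.toAdd), ?_⟩
  rw [eq_div_iff_mul_eq', ← map_mul]
  congr 1
  apply congrArg Multiplicative.ofAdd
  show (a.toAdd - b.toAdd) + b.toAdd = a.toAdd
  exact tsub_add_cancel_of_le hle

/-- `(ℚ_{≥0}, +)` is pre-divisorial. [cite: MochizukiFrdI2008, Def. 1.1(i) p.19] -/
theorem isPreDivisorial_M : IsPreDivisorial M :=
  { isIntegral := isIntegral_M, isSaturated := isSaturated_M, isOfCharType := isOfCharType_M }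

/-- `(ℚ_{≥0}, +)` is perfect: multiplication by `n ≥ 1` is bijective. [cite: MochizukiFrdI2008, §0 p.10] -/
theorem isPerfect_M : IsPerfect M := by
  refine ⟨fun n hn => ⟨fun a b h => ?_, fun b => ?_⟩⟩
  · have h' : n • a.toAdd = n • b.toAdd := by
      have := congrArg Multiplicative.toAdd h; rwa [toAdd_pow, toAdd_pow] at this
    exact Multiplicative.toAdd.injective
      (le_antisymm (le_of_nsmul_le_nsmul_right hn.ne' h'.le) (le_of_nsmul_le_nsmul_right hn.ne' h'.ge))
  · refine ⟨Multiplicative.ofAdd (b.toAdd / n), ?_⟩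
    show Multiplicative.ofAdd (b.toAdd / n) ^ n = b
    rw [← ofAdd_nsmul, nsmul_eq_mul, mul_div_cancel₀ _ (Nat.cast_ne_zero.mpr hn.ne'), ofAdd_toAdd]

/-- `(ℚ_{≥0}, +)` is `ℚ`-monoprime, as is its characteristic `(ℚ_{≥0})^char` (no units).
[cite: MochizukiFrdI2008, §0 p.10] -/
theorem isMonoprime_associates_M : IsMonoprime (Associates M) := by
  refine IsMonoprime.ofQ ⟨⟨?_⟩⟩
  -- `Associates M ≃* M`: units are trivial, so `Associated x y ↔ x = y`
  haveI : Subsingleton Mˣ := ⟨fun u v => Units.ext ((eq_one_of_isUnit_M _ u.isUnit).trans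
    (eq_one_of_isUnit_M _ v.isUnit).symm)⟩
  haveI : Unique Mˣ := uniqueOfSubsingleton 1
  exact
    { toFun := fun a => Quotient.liftOn a id fun x y (h : Associated x y) => associated_iff_eq.mp h
      invFun := Associates.mk
      left_inv := fun a => by
        obtain ⟨x, rfl⟩ := Associates.mk_surjective a
        rfl
      right_inv := fun x => rfl
      map_mul' := fun a b => by
        obtain ⟨x, rfl⟩ := Associates.mk_surjective a
        obtain ⟨y, rfl⟩ := Associates.mk_surjective b
        rfl }

/-! ### The one-morphism base and the constant monoid `Φ_{ℚ_{≥0}}` -/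

/-- The base category: the one-morphism category. [cite: MochizukiFrdI2008, Def. 1.1(iii) p.20] -/
abbrev D : Type := Discrete PUnit.{1}

/-- The constant monoid `Φ_{ℚ_{≥0}}` on the one-morphism category (transparent structure, values compute;
= found's `constMonoidOn M`). [cite: MochizukiFrdI2008, Def. 1.1(iii) p.20] -/
abbrev Φq : Dᵒᵖ ⥤ CommMonCat.{0} where
  obj _ := CommMonCat.of M
  map _ := 𝟙 _

/-- The pull-back maps of `Φ_{ℚ_{≥0}}` are identities. [cite: MochizukiFrdI2008, Def. 1.1(ii) p.19] -/
theorem pull_Φq {X Y : D} (g : X ⟶ Y) (x : Φq.obj (op Y)) : pull Φq g x = x := rfl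

/-- Every arrow of the one-morphism category is an isomorphism. [cite: MochizukiFrdI2008, Def. 1.1(iii) p.20] -/
theorem isIso_D {X Y : D} (f : X ⟶ Y) : IsIso f :=
  ⟨⟨eqToHom (by cases X; cases Y; rfl), Subsingleton.elim _ _, Subsingleton.elim _ _⟩⟩

/-- The one-morphism category is connected. [cite: MochizukiFrdI2008, Def. 1.1(iii) p.20] -/
theorem isGraphConnected_D : IsGraphConnected D :=
  ⟨⟨⟨PUnit.unit⟩⟩, fun X Y => by cases X; cases Y; exact Zigzag.refl _⟩

/-- The one-morphism category is totally epimorphic. [cite: MochizukiFrdI2008, Def. 1.1(iii) p.20] -/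
theorem isTotallyEpimorphic_D : IsTotallyEpimorphic D :=
  ⟨fun f => by haveI := isIso_D f; infer_instance⟩

/-- `Φ_{ℚ_{≥0}}` is a monoid on the one-morphism category. [cite: MochizukiFrdI2008, Def. 1.1(ii) p.19] -/
theorem isMonoidOn_Φq : IsMonoidOn Φq where
  isCharInjective f := by
    refine ⟨fun x y h => h, fun x y hxy => ?_⟩
    obtain ⟨a, rfl⟩ := Associates.mk_surjective x
    obtain ⟨b, rfl⟩ := Associates.mk_surjective y
    rw [associatesMap_mk, associatesMap_mk] at hxy
    exact hxy
  bijective_of_isFSM f _ := ⟨fun x y h => h, fun y => ⟨y, rfl⟩⟩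

/-- `Φ_{ℚ_{≥0}}` is objectwise pre-divisorial. [cite: MochizukiFrdI2008, Def. 1.1(ii) p.19] -/
theorem objectwise_isPreDivisorial_Φq : Objectwise (fun N _ => IsPreDivisorial N) Φq :=
  fun _ => isPreDivisorial_M

/-- The Frobenioid of the witness: `F_{Φ_{ℚ_{≥0}}} → F_{Φ^char}` (Prop. 1.5 (i)). [cite: MochizukiFrdI2008, Prop. 1.5(i) p.27] -/
abbrev F : ElemFrobenioid Φq ⥤ ElemFrobenioid (charFunctor Φq) := ElemFrobenioid.toChar Φq

/-- It is a Frobenioid (Prop. 1.5 (i)). [cite: MochizukiFrdI2008, Prop. 1.5(i) p.27] -/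
theorem isFrobenioid : PreFrobenioid.IsFrobenioid F :=
  ElemFrobenioid.isFrobenioid_toChar isMonoidOn_Φq objectwise_isPreDivisorial_Φq
    isGraphConnected_D isTotallyEpimorphic_D

/-- … of isotropic type (Prop. 1.5 (i)). [cite: MochizukiFrdI2008, Prop. 1.5(i) p.27] -/
theorem isOfIsotropicType : PreFrobenioid.IsOfIsotropicType F := fun A => ElemFrobenioid.isIsotropic A

/-- … of perfect type (Prop. 1.5 (iii)). [cite: MochizukiFrdI2008, Prop. 1.5(iii) p.27] -/
theorem isOfPerfectType : PreFrobenioid.IsOfPerfectType F :=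
  ElemFrobenioid.isOfPerfectType fun _ => isPerfect_M

/-- … with perf-factorial divisor monoids `Φ^char(∗) ≅ ℚ_{≥0}` (monoprime). [cite: MochizukiFrdI2008, Def. 2.4(i) p.47] -/
theorem perfFactorial : Objectwise (fun N _ => IsPerfFactorial N) (charFunctor Φq) :=
  fun _ => Literature.AnabelianGeometry.EtaleTheta.MonoprimeStructure.isPerfFactorial isMonoprime_associates_M

/-! ### The remaining hypotheses of `FrdI.T42.Setting` at `Ψ = id` -/

/-- `Φ^char_{ℚ_{≥0}}` is non-dilating: its pull-back maps are identities. [cite: MochizukiFrdI2008, Def. 1.1(ii) p.19] -/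
theorem isNonDilatingOn : IsNonDilatingOn (charFunctor Φq) := by
  intro X g _
  apply MonoidHom.ext
  intro a
  obtain ⟨x, rfl⟩ := Associates.mk_surjective a
  obtain ⟨y, rfl⟩ := Associates.mk_surjective x
  rw [associatesMap_mk, MonoidHom.id_apply, pull_charFunctor, associatesMap_mk]
  rfl

/-- The hypotheses `FrdI.T42.Setting` hold for `(F, F, id)`. [cite: MochizukiFrdI2008, Thm. 4.2 p.77] -/
theorem setting : T42.Setting F F (CategoryTheory.Equivalence.refl (C := ElemFrobenioid Φq)) where
  isFrobenioid₁ := isFrobenioid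
  isFrobenioid₂ := isFrobenioid
  perfect₁ := isOfPerfectType
  perfect₂ := isOfPerfectType
  isotropic₁ := isOfIsotropicType
  isotropic₂ := isOfIsotropicType
  perfFactorial₁ := perfFactorial
  perfFactorial₂ := perfFactorial
  preStep_map _ _ _ h := h
  preStep_inv _ _ _ h := h
  step_map _ _ _ h := h
  step_inv _ _ _ h := h
  frobeniusType_map _ _ _ h := h
  frobeniusType_inv _ _ _ h := h
  degFr_map _ _ _ := rfl
  pullback_map _ _ _ h := h
  pullback_inv _ _ _ h := h

/-! ### The arrows of the witness -/

/-- The unique object. [cite: MochizukiFrdI2008, Def. 1.1(iii) p.20] -/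
abbrev A : ElemFrobenioid Φq := ElemFrobenioid.of Φq ⟨PUnit.unit⟩

/-- The endomorphism `(id, q, 1)` of `A` with zero divisor `q ∈ ℚ_{≥0}`. [cite: MochizukiFrdI2008, Def. 1.1(iii) p.20] -/
def e (q : NNRat) : A ⟶ A := ElemFrobenioid.homMk (𝟙 _) (Multiplicative.ofAdd q) 1

/-- `(id, q, 1)` is a pre-step. [cite: MochizukiFrdI2008, Def. 1.2(iii) p.22] -/
theorem isPreStep_e (q : NNRat) : PreFrobenioid.IsPreStep F (e q) := ⟨rfl, isIso_D _⟩

/-- `Div(id, q, 1) = [q]` in `Φ^char`. [cite: MochizukiFrdI2008, Def. 1.1(iii) p.20] -/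
theorem div_e (q : NNRat) : PreFrobenioid.Div F (e q) = Associates.mk (Multiplicative.ofAdd q) := rfl

/-- `(id, q, 1)` is not an isomorphism for `q ≠ 0`, hence a step. [cite: MochizukiFrdI2008, Def. 1.2(iii) p.22] -/
theorem isStep_e {q : NNRat} (hq : q ≠ 0) : PreFrobenioid.IsStep F (e q) := by
  refine ⟨isPreStep_e q, fun h => hq ?_⟩
  have hu := ElemFrobenioid.isUnit_div_of_isIso (e q)
  have h1 : Multiplicative.ofAdd q = (1 : M) := eq_one_of_isUnit_M _ hu
  exact congrArg Multiplicative.toAdd h1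

/-- Divisibility in `(ℚ_{≥0}, +)` written multiplicatively is `≤`. [cite: MochizukiFrdI2008, §0 p.10] -/
theorem ofAdd_dvd_ofAdd {q r : NNRat} (h : q ≤ r) :
    (Multiplicative.ofAdd q : M) ∣ Multiplicative.ofAdd r := by
  obtain ⟨c, rfl⟩ := le_iff_exists_add.mp h
  exact ⟨Multiplicative.ofAdd c, rfl⟩

/-- Every `[q]`, `q ≠ 0`, is a primary element of `Φ^char = (ℚ_{≥0})^char` (the monoid is monoprime:
any two non-trivial elements are `≼`-equivalent, by the archimedean property). [cite: MochizukiFrdI2008, §0 p.12] -/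
theorem isPrimary_mk {q : NNRat} (hq : q ≠ 0) :
    IsPrimary (Associates.mk (Multiplicative.ofAdd q) : Associates M) := by
  refine ⟨fun h => hq ?_, fun b hb _ => ?_⟩
  · have hu : IsUnit (Multiplicative.ofAdd q : M) := Associates.mk_eq_one.mp h
    exact congrArg Multiplicative.toAdd (eq_one_of_isUnit_M _ hu)
  · obtain ⟨y, rfl⟩ := Associates.mk_surjective b
    have hy : Multiplicative.toAdd y ≠ 0 := by
      intro h0
      apply hb
      have : y = 1 := by rw [← ofAdd_toAdd y, h0]; rfl
      rw [this, Associates.mk_one]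
    obtain ⟨n, hn⟩ := Archimedean.arch q (pos_iff_ne_zero.mpr hy)
    refine ⟨n + 1, Nat.succ_pos n, ?_⟩
    rw [← Associates.mk_pow, Associates.mk_dvd_mk, ← ofAdd_toAdd y, ← ofAdd_nsmul]
    exact ofAdd_dvd_ofAdd (hn.trans (nsmul_le_nsmul_left zero_le (Nat.le_succ n)))

/-- `(id, q, 1)`, `q ≠ 0`, is a primary pre-step. [cite: MochizukiFrdI2008, Def. 1.2(iii) p.22] -/
theorem isPrimaryPreStep_e {q : NNRat} (hq : q ≠ 0) : PreFrobenioid.IsPrimaryPreStep F (e q) :=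
  ⟨isPreStep_e q, isPrimary_mk hq⟩

/-- Pre-steps of `F` are monomorphisms (Def. 1.3 (v)(a)). [cite: MochizukiFrdI2008, Def. 1.3(v) p.25] -/
theorem mono_e (q : NNRat) : Mono (e q) := isFrobenioid.v_a (e q) (isPreStep_e q)

/-- `(Φ β)⁻¹ Div(β) = [1]` for `β = (id, 1, 1)`. [cite: MochizukiFrdI2008, Def. 1.3(iii) p.25] -/
theorem invDiv_e (q : NNRat) (h : PreFrobenioid.IsBaseIso F (e q)) :
    PreFrobenioid.invDiv F (e q) h = Associates.mk (Multiplicative.ofAdd q) := by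
  unfold PreFrobenioid.invDiv
  rw [div_e, pull_charFunctor, associatesMap_mk]
  rfl

/-! ### The counter-model -/

/-- **Row T49-L08 as typed is false**: `¬ FrdI.T49.PsiPreservesTwinPrimary` (at universe level `0`). In
the elementary Frobenioid of the constant monoid `ℚ_{≥0}` on the one-morphism category (perfect,
isotropic, perf-factorial; `Ψ = id`), the arrows `β = δ = γ'' = (id,1,1)`, `γ = γ' = id`, `α = (id,2,1)`,
`δ' = β ≫ α` satisfy every hypothesis of the typed row — commutative squares, cartesian among pre-steps,
Div-equivalence, primary steps — but `Div(α) = [2] ≠ [1] = (Φ β)⁻¹ Div(β)`: `α`, `β` are not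
twin-primary. The missing printed hypothesis is the co-primarity "as in Proposition 4.1, (iii)" (here
`(δ', α)` is not co-primary); the repaired statement is `FrdI.T49.isTwinPrimary_map_of_coprimary_squares`.
[cite: MochizukiFrdI2008, Thm. 4.9 p.90] -/
theorem _root_.Literature.AlgebraicGeometry.Frobenioids.FrdI.T49.not_psiPreservesTwinPrimary :
    ¬ PsiPreservesTwinPrimary.{0, 0, 0, 0, 0} := by
  intro H
  have h1 : (1 : NNRat) ≠ 0 := one_ne_zero
  have h2 : (2 : NNRat) ≠ 0 := two_ne_zero
  haveI := mono_e 1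
  haveI := mono_e 2
  have key := H F F (CategoryTheory.Equivalence.refl (C := ElemFrobenioid Φq)) setting isNonDilatingOn
    isNonDilatingOn
    (fun _ _ _ h => h) (fun _ _ _ _ _ _ h => h) (e 2) (e 1) (𝟙 A) (𝟙 A) (e 1) (e 1) (e 1 ≫ e 2)
    (isStep_e h2) (isPrimaryPreStep_e h2) (isStep_e h1) (isPrimaryPreStep_e h1)
    (PreFrobenioid.isPreStep_of_isIso F _) (PreFrobenioid.isPreStep_of_isIso F _) (isPreStep_e 1)
    (isPreStep_e 1) (PreFrobenioid.IsPreStep.comp F (isPreStep_e 1) (isPreStep_e 2)) rfl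
    (by rw [Category.id_comp]) ?_ ?_ (by unfold PreFrobenioid.DivEquivalent; rw [Category.id_comp])
  · -- `Div α = [2]`, `(Φ β)⁻¹ Div β = [1]`: contradiction
    obtain ⟨⟨-, -, -, -, htwin⟩, -⟩ := key
    have h := htwin (isPreStep_e 1).2
    rw [div_e, invDiv_e] at h
    have hassoc : Associated (Multiplicative.ofAdd (2 : NNRat) : M) (Multiplicative.ofAdd 1) :=
      Associates.mk_eq_mk_iff_associated.mp h
    haveI : Subsingleton Mˣ := ⟨fun u v => Units.ext ((eq_one_of_isUnit_M _ u.isUnit).trans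
      (eq_one_of_isUnit_M _ v.isUnit).symm)⟩
    haveI : Unique Mˣ := uniqueOfSubsingleton 1
    have h' : (2 : NNRat) = 1 := congrArg Multiplicative.toAdd (associated_iff_eq.mp hassoc)
    norm_num at h'
  · -- the first square `id ≫ β = id ≫ β` is cartesian among pre-steps (`β` is a monomorphism)
    intro V a b _ _ hab
    have hab' : a = b := (cancel_mono (e 1)).mp hab
    subst hab'
    refine ⟨a, ⟨Category.comp_id a, Category.comp_id a⟩, fun u hu => ?_⟩
    rw [← hu.1, Category.comp_id]
  · -- the second square `id ≫ (β ≫ α) = β ≫ α` is cartesian among pre-steps (`α` is a monomorphism)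
    intro V a b _ _ hab
    have hab' : a ≫ e 1 = b := (cancel_mono (e 2)).mp (by rw [Category.assoc]; exact hab)
    subst hab'
    refine ⟨a, ⟨Category.comp_id a, rfl⟩, fun u hu => ?_⟩
    rw [← hu.1, Category.comp_id]

end FrdI.T49.Witness

end Literature.AlgebraicGeometry.Frobenioids

end
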